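import Summits.BirchSwinnertonDyer.BirchSwinnertonDyer.Theorems.EisensteinPrimesFiniteIndexThree
import HarnessLib

/-!
# The `λ`-identity of Keller–Yin Thm. 1.4.1 (iii) from its index inputs — the ABSTRACT ASSEMBLY of the V21 road
# (cell `bsd-eis`, seat `bsd-line-x1-p1` LEAD g4; crux 2 `GoodLatticeBDPValue` stmt-BirchSwinnertonDyer-19032, line `halves`)

HONEST FRAMING (cell `bsd-eis`, run/shared/lean/pub/bsd-eis/): pure algebra of abelian groups (no definition, no named fact,
no `sorry`, no `Theses` import); nothing about any curve is asserted; BSD / IMC2 / KY Thm. 1.4.1 are proved for NO curve here.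
Helper `--supports stmt-BirchSwinnertonDyer-19032`; closes no registered stub.

## What

`Cruxes/GoodLatticeBDPValue/Lines/halves-imprimLambda-index-road.md` (LEAD g4) reduces the bare `λ`-identity
`λ(𝔛^{Sf}_f) + [𝟙̃ = 𝟙] = λ(𝔛^{Sf}_ω̃) + λ(𝔛^{Sf}_𝟙̃)` (`stub_imprimLambda`) to finitely many inputs about the three modules
`A_? ∈ {E[p^∞], (F/𝒪)(ω̃), (F/𝒪)(𝟙̃)}` over `K_∞`. THIS FILE is the algebraic skeleton of that reduction with every
cohomology group replaced by an abstract abelian group: for each `? ∈ {ω, f, 1}` a surjection `loc_? : U_? ↠ P_?`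
("`H¹(K_Σ/K_∞, A_?) ↠ ⊕_{w∣v̄} H¹(K_{∞,w}, A_?)`", SUR) with `P_?` `p`-divisible (DIV_loc) and STRICT Selmer group
`S_? := ker loc_?` (`p`-primary with finite `p`-torsion, COT); residual groups `ρ_? : X_? → Y_?`
("`H¹(G, N_?) → ⊕_w H¹(G_w, N_?)`") with Kummer surjections `κ_? : X_? ↠ U_?[p]`, `κ'_? : Y_? ↠ P_?[p]` with finite kernels
("`A^G/p`, `⊕_w A^{G_w}/p`") intertwining `ρ_?` and `loc_?|[p]`; and the residual long exact sequences `X_ω →a X_f →b X_1`,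
`Y_ω →a' Y_f →b' Y_1 → 0` (LRS_loc) compatible with the `ρ`'s, `ker a`, `ker a'` finite. THEN (`natCard_lambda_identity`):
`p^{λ_f} · #ker a · #coker b · #ker κ_f · #ker κ'_ω · #ker κ'_1 · #(U_f/p)
   = p^{λ_ω + λ_1} · #ker a' · #ker κ_ω · #ker κ_1 · #ker κ'_f · #(U_ω/p) · #(U_1/p)`  (`λ_? = zpCorank S_?`),
all the finiteness being DERIVED (`coker b` included). With the arithmetic of the road's steps (5)–(6) as hypotheses —
`#ker κ_? = 1` (no global `H⁰` mod `p`), `#ker κ'_ω = #ker κ'_1 = 1`, `#ker a = p^ε`, `#ker a' · #ker κ'_f = p^s` (the local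
cancellation), `#coker b · #(U_f/p) = #(U_ω/p) · #(U_1/p)` (the `H²` bookkeeping) — the corollary
`zpCorank_add_eq_of_index_inputs` reads **`λ_f + ε = λ_ω + λ_1 + s`** (road step (7)). Ingredients: files
`…FiniteIndexSnake` (p642332), `…FiniteIndexThree` (six-term rule for `×p`, `natCard_index_three`), tree
`pow_zpCorank_mul_natCard_modN`.

References: [KellerYin2024] Thm. 1.4.1 and §1.4 (arXiv:2402.12781v2 TeX L1087–1330); [MilneADT2006] I §2; the road memo.
-/

set_option autoImplicit false
set_option linter.dupNamespace false -- the summit namespace `…BirchSwinnertonDyer.BirchSwinnertonDyer.Theorems` (Sub = Summit, D-0017) trips it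

noncomputable section

open scoped AddSubgroup

open Function Literature.NumberTheory.EllipticCurves

namespace Summit.BirchSwinnertonDyer.BirchSwinnertonDyer.Theorems.FiniteIndexCalculus

/-! ## §1 Finiteness lemmas -/

section Finiteness

variable {S U P : Type*} [AddCommGroup S] [AddCommGroup U] [AddCommGroup P] {ι : S →+ U} {π : U →+ P} {p : ℕ}

/-- Along `0 → S →ι U →π P` (exact, `ι` injective) with `S[p]` finite, `ker(π|[p])` is finite. [folklore] -/
theorem finite_ker_torsionByMap (hι : Injective ι) (hex : Exact ι π) [Finite S[(p : ℤ)]] :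
    Finite (torsionByMap π p).ker := by
  rw [ker_torsionByMap_eq_range hι (fun u hu ↦ by
      obtain ⟨s, hs⟩ := (hex u).mp hu; exact ⟨s, hs⟩) (fun s ↦ hex.apply_apply_eq_zero s)]
  exact Finite.of_surjective _ (torsionByMap ι p).rangeRestrict_surjective

/-- Along a short exact `0 → S →ι U →π P → 0` with `S/pS` finite, `coker(π|[p] : U[p] → P[p])` is finite (it embeds in
`S/pS` by the connecting map of the snake lemma). [folklore] -/
theorem finite_coker_torsionByMap [Fact p.Prime] (hι : Injective ι) (hπ : Surjective π) (hex : Exact ι π)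
    [Finite (ModN S p)] : Finite (P[(p : ℤ)] ⧸ (torsionByMap π p).range) := by
  let iₗ : S →ₗ[ℤ] U := ι.toIntLinearMap
  let fₗ : U →ₗ[ℤ] P := π.toIntLinearMap
  have hexl : Exact iₗ fₗ := hex
  have hfₗ : Surjective fₗ := hπ
  have hiₗ : Injective iₗ := hι
  let mS : S →ₗ[ℤ] S := LinearMap.lsmul ℤ S p
  let mU : U →ₗ[ℤ] U := LinearMap.lsmul ℤ U p
  let mP : P →ₗ[ℤ] P := LinearMap.lsmul ℤ P p
  have h₁ : iₗ.comp mS = mU.comp iₗ := LinearMap.ext fun a ↦ by simp [iₗ, mS, mU]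
  have h₂ : fₗ.comp mU = mP.comp fₗ := LinearMap.ext fun b ↦ by simp [fₗ, mU, mP]
  let ι₂ : U[(p : ℤ)] →ₗ[ℤ] U := (U[(p : ℤ)]).subtype.toIntLinearMap
  let ι₃ : P[(p : ℤ)] →ₗ[ℤ] P := (P[(p : ℤ)]).subtype.toIntLinearMap
  have hι₂ : Exact ι₂ mU := exact_subtype_torsionBy_lsmul p
  have hι₃ : Exact ι₃ mP := exact_subtype_torsionBy_lsmul p
  let π₁ : S →ₗ[ℤ] ModN S p := (LinearMap.range mS).mkQ
  have hπ₁ : Exact mS π₁ := LinearMap.exact_map_mkQ_range mS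
  let F : U[(p : ℤ)] →ₗ[ℤ] P[(p : ℤ)] := (torsionByMap π p).toIntLinearMap
  have hF : fₗ.comp ι₂ = ι₃.comp F := LinearMap.ext fun _ ↦ rfl
  let δ : P[(p : ℤ)] →ₗ[ℤ] ModN S p :=
    SnakeLemma.δ' mS mU mP iₗ fₗ hexl iₗ fₗ hexl h₁ h₂ ι₃ hι₃ π₁ hπ₁ hfₗ hiₗ
  have hδr : Exact (torsionByMap π p) δ.toAddMonoidHom :=
    SnakeLemma.exact_δ'_right mS mU mP iₗ fₗ hexl iₗ fₗ hexl h₁ h₂ ι₂ hι₂ ι₃ hι₃ π₁ hπ₁ hfₗ hiₗ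
      F hF Subtype.val_injective
  rw [← hδr.addMonoidHom_ker_eq]
  exact Finite.of_equiv _ (QuotientAddGroup.quotientKerEquivRange δ.toAddMonoidHom).symm.toEquiv

/-- Finiteness transport backwards along surjections: if `ℓ ∘ κ = κ' ∘ ρ` with `κ, κ'` onto with finite kernels and
`ℓ` has finite kernel and cokernel, so does `ρ`. [folklore] -/
theorem finite_ker_coker_of_surjective_rev {X Y X' Y' : Type*} [AddCommGroup X] [AddCommGroup Y] [AddCommGroup X']
    [AddCommGroup Y'] (ρ : X →+ Y) (ℓ : X' →+ Y') (κ : X →+ X') (κ' : Y →+ Y') (hκ : Surjective κ)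
    (hsq : ∀ x, ℓ (κ x) = κ' (ρ x)) [Finite κ.ker] [Finite κ'.ker] [Finite ℓ.ker] [Finite (Y' ⧸ ℓ.range)] :
    Finite ρ.ker ∧ Finite (Y ⧸ ρ.range) := by
  constructor
  · -- `ker ρ ≤ κ⁻¹(ker ℓ)`, an extension of a subgroup of `ker ℓ` by `ker κ`
    let Z : AddSubgroup X := ℓ.ker.comap κ
    let φ : κ.ker →+ Z := (κ.ker.subtype).codRestrict Z fun x ↦ by
      change κ (x : X) ∈ ℓ.ker
      rw [(AddMonoidHom.mem_ker).1 x.2]; exact zero_mem _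
    let ψ : Z →+ ℓ.ker := (κ.comp Z.subtype).codRestrict ℓ.ker fun z ↦ z.2
    have hφψ : Exact φ ψ := by
      intro z
      constructor
      · intro hz
        have hz' : κ (z : X) = 0 := congrArg Subtype.val hz
        exact ⟨⟨(z : X), hz'⟩, Subtype.ext rfl⟩
      · rintro ⟨x, rfl⟩
        exact Subtype.ext ((AddMonoidHom.mem_ker).1 x.2)
    haveI : Finite Z := finite_of_exact φ ψ hφψ
    have hmem : ∀ x : ρ.ker, (x : X) ∈ Z := fun x ↦ by
      change κ (x : X) ∈ ℓ.ker
      rw [AddMonoidHom.mem_ker, hsq, (AddMonoidHom.mem_ker).1 x.2, map_zero]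
    let θ : ρ.ker →+ Z := ρ.ker.subtype.codRestrict Z hmem
    exact Finite.of_injective θ fun x y h ↦ Subtype.ext (congrArg (fun z : Z ↦ (z : X)) h)
  · -- `Y/ρ(X) → Y'/ℓ(X')` has kernel the image of `ker κ'` (as `ℓ(X') = κ'(ρ(X))`) and finite target
    let G : Y ⧸ ρ.range →+ Y' ⧸ ℓ.range := QuotientAddGroup.map ρ.range ℓ.range κ' (by
      rintro _ ⟨x, rfl⟩
      exact ⟨κ x, hsq x⟩)
    let φ : κ'.ker →+ Y ⧸ ρ.range := (QuotientAddGroup.mk' ρ.range).comp κ'.ker.subtype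
    have hφG : Exact φ G := by
      intro q
      obtain ⟨y, rfl⟩ := QuotientAddGroup.mk'_surjective ρ.range q
      constructor
      · intro hq
        have hy : κ' y ∈ ℓ.range := by
          have : QuotientAddGroup.mk' ℓ.range (κ' y) = 0 := hq
          rwa [QuotientAddGroup.mk'_apply, QuotientAddGroup.eq_zero_iff] at this
        obtain ⟨x', hx'⟩ := hy
        obtain ⟨x, rfl⟩ := hκ x'
        have hk : y - ρ x ∈ κ'.ker := by
          rw [AddMonoidHom.mem_ker, map_sub, ← hsq, hx', sub_self]
        refine ⟨⟨y - ρ x, hk⟩, ?_⟩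
        change QuotientAddGroup.mk' ρ.range (y - ρ x) = QuotientAddGroup.mk' ρ.range y
        rw [map_sub, sub_eq_self, QuotientAddGroup.mk'_apply, QuotientAddGroup.eq_zero_iff]
        exact ⟨x, rfl⟩
      · rintro ⟨k, hk⟩
        rw [← hk]
        change QuotientAddGroup.mk' ℓ.range (κ' (k : Y)) = 0
        rw [(AddMonoidHom.mem_ker).1 k.2, map_zero]
    exact finite_of_exact φ G hφG

/-- Along a morphism `(ρ_f, ρ_1)` of pairs `X_f →b X_1` over `Y_f →b' Y_1` (`ρ_1 ∘ b = b' ∘ ρ_f`): if `ker ρ_1` and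
`coker ρ_f` are finite then `coker b` is finite — `X_1/b(X_f)` is an extension of a subgroup of `Y_1/ρ_1(b(X_f))` (onto which
`coker ρ_f` maps by `b'`) by the image of `ker ρ_1`. So the finiteness of `coker(H¹(G,E[p]) → H¹(G,𝔽(𝟙̃)))` is automatic.
[folklore] -/
theorem finite_coker_of_morphism {Xf X1 Yf Y1 : Type*} [AddCommGroup Xf] [AddCommGroup X1] [AddCommGroup Yf]
    [AddCommGroup Y1] (b : Xf →+ X1) (b' : Yf →+ Y1) (ρf : Xf →+ Yf) (ρ1 : X1 →+ Y1) (hb' : Surjective b')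
    (sq₂ : ∀ x, ρ1 (b x) = b' (ρf x)) [Finite ρ1.ker] [Finite (Yf ⧸ ρf.range)] : Finite (X1 ⧸ b.range) := by
  set T := ρ1.comp b.range.subtype with hT
  -- `Yf/ρf(Xf) ↠ Y1/T(im b)`
  let G : Yf ⧸ ρf.range →+ Y1 ⧸ T.range := QuotientAddGroup.map ρf.range T.range b' (by
    rintro _ ⟨x, rfl⟩
    exact ⟨⟨b x, x, rfl⟩, sq₂ x⟩)
  have hG : Surjective G := fun q ↦ by
    obtain ⟨y, rfl⟩ := QuotientAddGroup.mk'_surjective T.range q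
    obtain ⟨z, rfl⟩ := hb' y
    exact ⟨QuotientAddGroup.mk' ρf.range z, rfl⟩
  haveI : Finite (Y1 ⧸ T.range) := Finite.of_surjective G hG
  -- `ker ρ1 → X1/im b → Y1/T(im b)` exact in the middle
  let φ : ρ1.ker →+ X1 ⧸ b.range := (QuotientAddGroup.mk' b.range).comp ρ1.ker.subtype
  let ψ : X1 ⧸ b.range →+ Y1 ⧸ T.range := QuotientAddGroup.map b.range T.range ρ1 (by
    intro x hx
    exact ⟨⟨x, hx⟩, rfl⟩)
  have hφψ : Exact φ ψ := by
    intro q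
    obtain ⟨x, rfl⟩ := QuotientAddGroup.mk'_surjective b.range q
    constructor
    · intro hq
      have hx : ρ1 x ∈ T.range := by
        have : QuotientAddGroup.mk' T.range (ρ1 x) = 0 := hq
        rwa [QuotientAddGroup.mk'_apply, QuotientAddGroup.eq_zero_iff] at this
      obtain ⟨y, hy⟩ := hx
      have hk : x - (y : X1) ∈ ρ1.ker := by
        rw [AddMonoidHom.mem_ker, map_sub, ← hy, hT, AddMonoidHom.comp_apply, AddSubgroup.coe_subtype, sub_self]
      refine ⟨⟨x - (y : X1), hk⟩, ?_⟩
      change QuotientAddGroup.mk' b.range (x - (y : X1)) = QuotientAddGroup.mk' b.range x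
      rw [map_sub, sub_eq_self, QuotientAddGroup.mk'_apply, QuotientAddGroup.eq_zero_iff]
      exact y.2
    · rintro ⟨k, hk⟩
      rw [← hk]
      change QuotientAddGroup.mk' T.range (ρ1 (k : X1)) = 0
      rw [(AddMonoidHom.mem_ker).1 k.2, map_zero]
  exact finite_of_exact φ ψ hφψ

end Finiteness

/-! ## §2 One module: `h(ρ_N) = p^{λ(A)} · #(U(A)/p) · #ker κ / #ker κ'` (road steps (1)–(2)) -/

section Module

variable {U P X Y : Type*} [AddCommGroup U] [AddCommGroup P] [AddCommGroup X] [AddCommGroup Y] {p : ℕ} [Fact p.Prime]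

/-- **Steps (1)–(2) of the road for ONE module.** `loc : U ↠ P` onto with `P` `p`-divisible, `S := ker loc` `p`-primary with
finite `p`-torsion; `ρ : X → Y` ("residual localisation") with Kummer surjections `κ : X ↠ U[p]`, `κ' : Y ↠ P[p]` with finite
kernels intertwining `ρ` and `loc|[p]`. Then `ρ` has finite kernel and cokernel and
`#ker ρ · #ker κ' = p^{corank S} · #(U/pU) · #coker ρ · #ker κ` — i.e. `ind ρ = λ(S) + d(U/pU) + d ker κ − d ker κ'`
(`λ = ind ℓ − d(U/p)`, `ind ℓ = ind ρ − d ker κ + d ker κ'`, `ℓ = loc|[p]`). [cite: MilneADT2006, I §2]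
[cite: KellerYin2024, §1.4 (arXiv:2402.12781v2), Lemma 1.2.4 and (Seltolambda)] -/
theorem natCard_ker_mul_of_module (loc : U →+ P) (hloc : Surjective loc) (hdiv : ∀ y : P, ∃ y' : P, p • y' = y)
    (hprim : ∀ s : loc.ker, ∃ n : ℕ, p ^ n • s = 0) [Finite (AddSubgroup.torsionBy loc.ker (p : ℤ))]
    (ρ : X →+ Y) (κ : X →+ U[(p : ℤ)]) (κ' : Y →+ P[(p : ℤ)]) (hκ : Surjective κ) (hκ' : Surjective κ')
    (hsq : ∀ x, torsionByMap loc p (κ x) = κ' (ρ x)) [Finite κ.ker] [Finite κ'.ker] :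
    Finite ρ.ker ∧ Finite (Y ⧸ ρ.range) ∧ 0 < Nat.card (ModN U p) ∧
      Nat.card ρ.ker * Nat.card κ'.ker =
        p ^ zpCorank loc.ker p * Nat.card (ModN U p) * Nat.card (Y ⧸ ρ.range) * Nat.card κ.ker := by
  have hex : Exact loc.ker.subtype loc := exact_ker_subtype loc
  obtain ⟨hfinS, -⟩ := finite_modN_of_primary hprim
  haveI := hfinS
  haveI : Finite (torsionByMap loc p).ker := finite_ker_torsionByMap Subtype.val_injective hex
  haveI : Finite (P[(p : ℤ)] ⧸ (torsionByMap loc p).range) :=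
    finite_coker_torsionByMap Subtype.val_injective hloc hex
  obtain ⟨hKρ, hCρ⟩ := finite_ker_coker_of_surjective_rev ρ (torsionByMap loc p) κ κ' hκ hsq
  haveI := hKρ
  haveI := hCρ
  -- (1): `#ker ℓ = #S[p]`, `#(S/p) = #coker ℓ · #(U/p)`, `p^λ · #(S/p) = #S[p]`
  have e₁ := natCard_ker_torsionByMap_eq (p := p) Subtype.val_injective hex
  have e₂ := natCard_modN_eq_coker_mul (p := p) Subtype.val_injective hloc hex hdiv
  have e₃ := pow_zpCorank_mul_natCard_modN (p := p) hprim
  -- (2): the quotient rule along the Kummer surjections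
  have e₄ := natCard_ker_mul_of_surjective ρ (torsionByMap loc p) κ κ' hκ hκ' hsq
  have hUpos : 0 < Nat.card (ModN U p) := by
    rcases Nat.eq_zero_or_pos (Nat.card (ModN U p)) with h | h
    · exfalso
      rw [h, mul_zero] at e₂
      exact (Nat.card_pos (α := ModN loc.ker p)).ne' e₂
    · exact h
  refine ⟨hKρ, hCρ, hUpos, ?_⟩
  have hcpos : 0 < Nat.card (P[(p : ℤ)] ⧸ (torsionByMap loc p).range) := Nat.card_pos
  refine Nat.eq_of_mul_eq_mul_left hcpos ?_
  calc Nat.card (P[(p : ℤ)] ⧸ (torsionByMap loc p).range) * (Nat.card ρ.ker * Nat.card κ'.ker)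
      = Nat.card ρ.ker * Nat.card (P[(p : ℤ)] ⧸ (torsionByMap loc p).range) * Nat.card κ'.ker := by ring
    _ = Nat.card (torsionByMap loc p).ker * Nat.card (Y ⧸ ρ.range) * Nat.card κ.ker := e₄
    _ = p ^ zpCorank loc.ker p * Nat.card (ModN loc.ker p) * Nat.card (Y ⧸ ρ.range) * Nat.card κ.ker := by
        rw [e₁, e₃]
    _ = Nat.card (P[(p : ℤ)] ⧸ (torsionByMap loc p).range) *
          (p ^ zpCorank loc.ker p * Nat.card (ModN U p) * Nat.card (Y ⧸ ρ.range) * Nat.card κ.ker) := by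
        rw [e₂]; ring

end Module

/-! ## §3 Three modules along the residual exact sequence: the `λ`-identity (road steps (3)–(7)) -/

section Identity

variable {Uω Pω Xω Yω Uf Pf Xf Yf U1 P1 X1 Y1 : Type*}
  [AddCommGroup Uω] [AddCommGroup Pω] [AddCommGroup Xω] [AddCommGroup Yω]
  [AddCommGroup Uf] [AddCommGroup Pf] [AddCommGroup Xf] [AddCommGroup Yf]
  [AddCommGroup U1] [AddCommGroup P1] [AddCommGroup X1] [AddCommGroup Y1]
  {p : ℕ} [Fact p.Prime]

/-- **The `λ`-identity from its index inputs (general form).** Three modules `? ∈ {ω, f, 1}` as in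
`natCard_ker_mul_of_module`, and residual exact sequences `X_ω →a X_f →b X_1`, `Y_ω →a' Y_f →b' Y_1 → 0` (finite
`ker a`, `ker a'`; `b'` onto) compatible with the `ρ_?`. Then
`p^{λ_f} · #ker a · #coker b · #ker κ_f · #ker κ'_ω · #ker κ'_1 · #(U_f/p)
   = p^{λ_ω + λ_1} · #ker a' · #ker κ_ω · #ker κ_1 · #ker κ'_f · #(U_ω/p) · #(U_1/p)`
(`λ_? = zpCorank (ker loc_?)`; `coker b` is finite, `finite_coker_of_morphism`).
[cite: KellerYin2024, Thm. 1.4.1 (iii) and §1.4 (arXiv:2402.12781v2 TeX L1087–1330)] [cite: MilneADT2006, I §2] -/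
theorem natCard_lambda_identity
    (locω : Uω →+ Pω) (locf : Uf →+ Pf) (loc1 : U1 →+ P1)
    (hlocω : Surjective locω) (hlocf : Surjective locf) (hloc1 : Surjective loc1)
    (hdivω : ∀ y : Pω, ∃ y' : Pω, p • y' = y) (hdivf : ∀ y : Pf, ∃ y' : Pf, p • y' = y)
    (hdiv1 : ∀ y : P1, ∃ y' : P1, p • y' = y)
    (hprimω : ∀ s : locω.ker, ∃ n : ℕ, p ^ n • s = 0) (hprimf : ∀ s : locf.ker, ∃ n : ℕ, p ^ n • s = 0)
    (hprim1 : ∀ s : loc1.ker, ∃ n : ℕ, p ^ n • s = 0)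
    [Finite (AddSubgroup.torsionBy locω.ker (p : ℤ))] [Finite (AddSubgroup.torsionBy locf.ker (p : ℤ))]
    [Finite (AddSubgroup.torsionBy loc1.ker (p : ℤ))]
    (ρω : Xω →+ Yω) (ρf : Xf →+ Yf) (ρ1 : X1 →+ Y1)
    (κω : Xω →+ Uω[(p : ℤ)]) (κ'ω : Yω →+ Pω[(p : ℤ)]) (κf : Xf →+ Uf[(p : ℤ)]) (κ'f : Yf →+ Pf[(p : ℤ)])
    (κ1 : X1 →+ U1[(p : ℤ)]) (κ'1 : Y1 →+ P1[(p : ℤ)])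
    (hκω : Surjective κω) (hκ'ω : Surjective κ'ω) (hκf : Surjective κf) (hκ'f : Surjective κ'f)
    (hκ1 : Surjective κ1) (hκ'1 : Surjective κ'1)
    (hKω : ∀ x, torsionByMap locω p (κω x) = κ'ω (ρω x)) (hKf : ∀ x, torsionByMap locf p (κf x) = κ'f (ρf x))
    (hK1 : ∀ x, torsionByMap loc1 p (κ1 x) = κ'1 (ρ1 x))
    [Finite κω.ker] [Finite κ'ω.ker] [Finite κf.ker] [Finite κ'f.ker] [Finite κ1.ker] [Finite κ'1.ker]
    (a : Xω →+ Xf) (b : Xf →+ X1) (a' : Yω →+ Yf) (b' : Yf →+ Y1) (hab : Exact a b) (hab' : Exact a' b')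
    (hb' : Surjective b') (sq₁ : ∀ x, ρf (a x) = a' (ρω x)) (sq₂ : ∀ x, ρ1 (b x) = b' (ρf x))
    [Finite a.ker] [Finite a'.ker] :
    Finite (X1 ⧸ b.range) ∧ 0 < Nat.card (ModN Uω p) ∧ 0 < Nat.card (ModN Uf p) ∧ 0 < Nat.card (ModN U1 p) ∧
    p ^ zpCorank locf.ker p * Nat.card a.ker * Nat.card (X1 ⧸ b.range) * Nat.card κf.ker * Nat.card κ'ω.ker *
          Nat.card κ'1.ker * Nat.card (ModN Uf p) =
      p ^ (zpCorank locω.ker p + zpCorank loc1.ker p) * Nat.card a'.ker * Nat.card κω.ker * Nat.card κ1.ker *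
          Nat.card κ'f.ker * Nat.card (ModN Uω p) * Nat.card (ModN U1 p) := by
  obtain ⟨hKω', hCω, huω, Eω⟩ := natCard_ker_mul_of_module locω hlocω hdivω hprimω ρω κω κ'ω hκω hκ'ω hKω
  obtain ⟨hKf', hCf, huf, Ef⟩ := natCard_ker_mul_of_module locf hlocf hdivf hprimf ρf κf κ'f hκf hκ'f hKf
  obtain ⟨hK1', hC1, hu1, E1⟩ := natCard_ker_mul_of_module loc1 hloc1 hdiv1 hprim1 ρ1 κ1 κ'1 hκ1 hκ'1 hK1
  haveI := hKω'; haveI := hCω; haveI := hKf'; haveI := hCf; haveI := hK1'; haveI := hC1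
  haveI : Finite (X1 ⧸ b.range) := finite_coker_of_morphism b b' ρf ρ1 hb' sq₂
  have E₃ := natCard_index_three a b a' b' ρω ρf ρ1 hab hab' hb' sq₁ sq₂
  refine ⟨inferInstance, huω, huf, hu1, ?_⟩
  -- abbreviations
  set Pω' := p ^ zpCorank locω.ker p
  set Pf' := p ^ zpCorank locf.ker p
  set P1' := p ^ zpCorank loc1.ker p
  have hcpos : 0 < Nat.card (Yω ⧸ ρω.range) * Nat.card (Yf ⧸ ρf.range) * Nat.card (Y1 ⧸ ρ1.range) :=
    Nat.mul_pos (Nat.mul_pos Nat.card_pos Nat.card_pos) Nat.card_pos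
  rw [pow_add]
  refine Nat.eq_of_mul_eq_mul_left hcpos ?_
  -- multiply `E₃` by `#ker κ'_f · #ker κ'_ω · #ker κ'_1` and substitute the three module identities
  calc Nat.card (Yω ⧸ ρω.range) * Nat.card (Yf ⧸ ρf.range) * Nat.card (Y1 ⧸ ρ1.range) *
        (Pf' * Nat.card a.ker * Nat.card (X1 ⧸ b.range) * Nat.card κf.ker * Nat.card κ'ω.ker * Nat.card κ'1.ker *
          Nat.card (ModN Uf p))
      = (Pf' * Nat.card (ModN Uf p) * Nat.card (Yf ⧸ ρf.range) * Nat.card κf.ker) *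
          (Nat.card (Yω ⧸ ρω.range) * Nat.card (Y1 ⧸ ρ1.range) * Nat.card a.ker * Nat.card (X1 ⧸ b.range)) *
          (Nat.card κ'ω.ker * Nat.card κ'1.ker) := by ring
    _ = (Nat.card ρf.ker * Nat.card κ'f.ker) *
          (Nat.card (Yω ⧸ ρω.range) * Nat.card (Y1 ⧸ ρ1.range) * Nat.card a.ker * Nat.card (X1 ⧸ b.range)) *
          (Nat.card κ'ω.ker * Nat.card κ'1.ker) := by rw [Ef]
    _ = (Nat.card ρf.ker * Nat.card (Yω ⧸ ρω.range) * Nat.card (Y1 ⧸ ρ1.range) * Nat.card a.ker *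
          Nat.card (X1 ⧸ b.range)) * (Nat.card κ'f.ker * Nat.card κ'ω.ker * Nat.card κ'1.ker) := by ring
    _ = (Nat.card ρω.ker * Nat.card ρ1.ker * Nat.card (Yf ⧸ ρf.range) * Nat.card a'.ker) *
          (Nat.card κ'f.ker * Nat.card κ'ω.ker * Nat.card κ'1.ker) := by rw [E₃]
    _ = (Nat.card ρω.ker * Nat.card κ'ω.ker) * (Nat.card ρ1.ker * Nat.card κ'1.ker) *
          (Nat.card (Yf ⧸ ρf.range) * Nat.card a'.ker * Nat.card κ'f.ker) := by ring
    _ = (Pω' * Nat.card (ModN Uω p) * Nat.card (Yω ⧸ ρω.range) * Nat.card κω.ker) *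
          (P1' * Nat.card (ModN U1 p) * Nat.card (Y1 ⧸ ρ1.range) * Nat.card κ1.ker) *
          (Nat.card (Yf ⧸ ρf.range) * Nat.card a'.ker * Nat.card κ'f.ker) := by rw [Eω, E1]
    _ = Nat.card (Yω ⧸ ρω.range) * Nat.card (Yf ⧸ ρf.range) * Nat.card (Y1 ⧸ ρ1.range) *
        (Pω' * P1' * Nat.card a'.ker * Nat.card κω.ker * Nat.card κ1.ker * Nat.card κ'f.ker *
          Nat.card (ModN Uω p) * Nat.card (ModN U1 p)) := by ring

/-- **The `λ`-identity of Keller–Yin Thm. 1.4.1 (iii), abstract form: `λ_f + ε = λ_ω + λ_1 + s`** from the index inputs of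
`natCard_lambda_identity` together with the arithmetic of the road's steps (5)–(6): no global `H⁰` mod `p`
(`#ker κ_? = 1`), no local `H⁰` mod `p` for the characters (`#ker κ'_ω = #ker κ'_1 = 1`), `#ker a = p^ε` (`ε = [𝟙̃|_{G_K} = 𝟙]`),
the LOCAL CANCELLATION `#ker a' · #ker κ'_f = p^s` (`s` = number of places of `K_∞` above `v̄`; KY's Cases I–III), and the
`H²` BOOKKEEPING `#coker b · #(U_f/p) = #(U_ω/p) · #(U_1/p)`. [cite: KellerYin2024, Thm. 1.4.1 (iii) (arXiv:2402.12781v2 TeX L1087–1098)] -/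
theorem zpCorank_add_eq_of_index_inputs
    (locω : Uω →+ Pω) (locf : Uf →+ Pf) (loc1 : U1 →+ P1)
    (hlocω : Surjective locω) (hlocf : Surjective locf) (hloc1 : Surjective loc1)
    (hdivω : ∀ y : Pω, ∃ y' : Pω, p • y' = y) (hdivf : ∀ y : Pf, ∃ y' : Pf, p • y' = y)
    (hdiv1 : ∀ y : P1, ∃ y' : P1, p • y' = y)
    (hprimω : ∀ s : locω.ker, ∃ n : ℕ, p ^ n • s = 0) (hprimf : ∀ s : locf.ker, ∃ n : ℕ, p ^ n • s = 0)
    (hprim1 : ∀ s : loc1.ker, ∃ n : ℕ, p ^ n • s = 0)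
    [Finite (AddSubgroup.torsionBy locω.ker (p : ℤ))] [Finite (AddSubgroup.torsionBy locf.ker (p : ℤ))]
    [Finite (AddSubgroup.torsionBy loc1.ker (p : ℤ))]
    (ρω : Xω →+ Yω) (ρf : Xf →+ Yf) (ρ1 : X1 →+ Y1)
    (κω : Xω →+ Uω[(p : ℤ)]) (κ'ω : Yω →+ Pω[(p : ℤ)]) (κf : Xf →+ Uf[(p : ℤ)]) (κ'f : Yf →+ Pf[(p : ℤ)])
    (κ1 : X1 →+ U1[(p : ℤ)]) (κ'1 : Y1 →+ P1[(p : ℤ)])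
    (hκω : Surjective κω) (hκ'ω : Surjective κ'ω) (hκf : Surjective κf) (hκ'f : Surjective κ'f)
    (hκ1 : Surjective κ1) (hκ'1 : Surjective κ'1)
    (hKω : ∀ x, torsionByMap locω p (κω x) = κ'ω (ρω x)) (hKf : ∀ x, torsionByMap locf p (κf x) = κ'f (ρf x))
    (hK1 : ∀ x, torsionByMap loc1 p (κ1 x) = κ'1 (ρ1 x))
    [Finite κω.ker] [Finite κ'ω.ker] [Finite κf.ker] [Finite κ'f.ker] [Finite κ1.ker] [Finite κ'1.ker]
    (a : Xω →+ Xf) (b : Xf →+ X1) (a' : Yω →+ Yf) (b' : Yf →+ Y1) (hab : Exact a b) (hab' : Exact a' b')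
    (hb' : Surjective b') (sq₁ : ∀ x, ρf (a x) = a' (ρω x)) (sq₂ : ∀ x, ρ1 (b x) = b' (ρf x))
    [Finite a.ker] [Finite a'.ker]
    -- the arithmetic inputs
    {ε s : ℕ} (hκω1 : Nat.card κω.ker = 1) (hκf1 : Nat.card κf.ker = 1) (hκ11 : Nat.card κ1.ker = 1)
    (hκ'ω1 : Nat.card κ'ω.ker = 1) (hκ'11 : Nat.card κ'1.ker = 1) (ha : Nat.card a.ker = p ^ ε)
    (hloc : Nat.card a'.ker * Nat.card κ'f.ker = p ^ s)
    (hH2 : Nat.card (X1 ⧸ b.range) * Nat.card (ModN Uf p) = Nat.card (ModN Uω p) * Nat.card (ModN U1 p)) :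
    zpCorank locf.ker p + ε = zpCorank locω.ker p + zpCorank loc1.ker p + s := by
  obtain ⟨-, huω, huf, hu1, E⟩ := natCard_lambda_identity locω locf loc1 hlocω hlocf hloc1 hdivω hdivf hdiv1 hprimω
    hprimf hprim1 ρω ρf ρ1 κω κ'ω κf κ'f κ1 κ'1 hκω hκ'ω hκf hκ'f hκ1 hκ'1 hKω hKf hK1 a b a' b' hab hab' hb' sq₁ sq₂
  rw [hκω1, hκf1, hκ11, hκ'ω1, hκ'11, ha] at E
  have hp : 1 < p := (Fact.out : p.Prime).one_lt
  have hupos : 0 < Nat.card (ModN Uω p) * Nat.card (ModN U1 p) := Nat.mul_pos huω hu1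
  have key : p ^ (zpCorank locf.ker p + ε) * (Nat.card (ModN Uω p) * Nat.card (ModN U1 p)) =
      p ^ (zpCorank locω.ker p + zpCorank loc1.ker p + s) * (Nat.card (ModN Uω p) * Nat.card (ModN U1 p)) := by
    calc p ^ (zpCorank locf.ker p + ε) * (Nat.card (ModN Uω p) * Nat.card (ModN U1 p))
        = p ^ zpCorank locf.ker p * p ^ ε * (Nat.card (X1 ⧸ b.range) * Nat.card (ModN Uf p)) := by
          rw [pow_add, hH2]
      _ = p ^ zpCorank locf.ker p * p ^ ε * Nat.card (X1 ⧸ b.range) * 1 * 1 * 1 * Nat.card (ModN Uf p) := by ring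
      _ = p ^ (zpCorank locω.ker p + zpCorank loc1.ker p) * Nat.card a'.ker * 1 * 1 * Nat.card κ'f.ker *
            Nat.card (ModN Uω p) * Nat.card (ModN U1 p) := E
      _ = p ^ (zpCorank locω.ker p + zpCorank loc1.ker p) * (Nat.card a'.ker * Nat.card κ'f.ker) *
            (Nat.card (ModN Uω p) * Nat.card (ModN U1 p)) := by ring
      _ = p ^ (zpCorank locω.ker p + zpCorank loc1.ker p + s) * (Nat.card (ModN Uω p) * Nat.card (ModN U1 p)) := by
          rw [hloc, ← pow_add]
  exact Nat.pow_right_injective hp (Nat.eq_of_mul_eq_mul_right hupos key)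

end Identity

end Summit.BirchSwinnertonDyer.BirchSwinnertonDyer.Theorems.FiniteIndexCalculus

end
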